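import Mathlib
import Summits.NavierStokesRegularity.NavierStokesRegularity.Theorems.FilamentSkeletonRssDefectColumnGateAzimuthalBlockExterior
import Summits.NavierStokesRegularity.NavierStokesRegularity.Theorems.FilamentSkeletonRssDefectColumnGateAzimuthalBlockRotationFlux
import Summits.NavierStokesRegularity.NavierStokesRegularity.Theorems.FilamentSkeletonRssDefectColumnGateAzimuthalBlockAssemblyKit

/-!
# Route `FilamentSkeletonRss` · crux `TransverseReduction1AG` (stmt-NavierStokesRegularity-27853; A1L twin stmt-23297) · line
# `defect_column_gate_1AG/1AL` — the EXTERIOR PACKAGE of the two-zone scheme for the Biot–Savart-coupled azimuthal blocks of S2a-loc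
# `WaistColumnGateLoc1A`: the V-blind exterior sup bound WITH the Biot–Savart source folded in (stage 3a of the assembly)

Helper file (`--supports stmt-NavierStokesRegularity-27853 --as helper`; seat ns-filament-s2aloc-p1 g2; note ARCHITECTURE-B2B3-s2aloc-g2.md v4 §7c).
`exterior_package`: for the COUPLED block (OU + rotation `m(ρ + RcΩ)` + column term `c_B φ`, `c_B = (γmRc/2)(γ/4π)e^{−γu/4}`) on `(0,∞)` with support
`[0,U]`, forcing `(1+u)²|f_i| ≤ M`, stream-source size `u|a|, u|b| ≤ N` on `(0,∞)`, any order `m ≠ 0` and any `u₀` with `64/γ ≤ u₀`: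
`∀ u ≥ u₀:  u⁴(a²+b²)(u) ≤ max(16M_E²/γ², u₀⁴(a²+b²)(u₀))`,  `M_E = M + (γ²Rc/(8π|m|))·(1+u₀)²e^{−γu₀/4}·N`
— `azimuthalBlock_exterior` (p671778) applied with `f′ = f − BS`, the source bounded by `abs_streamCoeff_le` (p672041: `|φ| ≤ N/m²`) and
`sq_mul_exp_neg_antitone` (p678004).  In the scheme `e^{−γu₀/4} = Rc^{−A}`, so the only place where the global size `N ≤ sup(1+u)²|w|` re-enters
carries the factor `Rc^{1−A}`.
HONEST FRAMING: an a-priori bound for ONE family of blocks of ONE linear MODEL operator of a hypothetical blow-up route (MODEL rung, negative side);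
nothing here bears on NS regularity.
-/

set_option linter.dupNamespace false

noncomputable section

namespace Summit.NavierStokesRegularity.NavierStokesRegularity.Theorems.DefectColumnGate

open scoped Topology
open Set Filter MeasureTheory intervalIntegral

set_option maxHeartbeats 800000 in
/-- **Exterior package (V-blind exterior sup bound with the Biot–Savart source folded in).**  See the module docstring. -/
theorem exterior_package {γ m ρ Rc u₀ U M N : ℝ} {a a₁ b b₁ φa φa₁ φb φb₁ f₁ f₂ : ℝ → ℝ}
    (hγ : 0 < γ) (hm : m ≠ 0) (hRc : 0 ≤ Rc) (hU : 0 < U) (hu₀ : 64 / γ ≤ u₀)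
    (ha : ContinuousOn a (Ici 0)) (hb : ContinuousOn b (Ici 0))
    (hφa : ContinuousOn φa (Ici 0)) (hφb : ContinuousOn φb (Ici 0)) (hφa0 : φa 0 = 0) (hφb0 : φb 0 = 0)
    (hdera : ∀ u, 0 < u → HasDerivAt a (a₁ u) u) (hderb : ∀ u, 0 < u → HasDerivAt b (b₁ u) u)
    (hderφa : ∀ u, 0 < u → HasDerivAt φa (φa₁ u) u) (hderφb : ∀ u, 0 < u → HasDerivAt φb (φb₁ u) u)
    (hΦa : ∀ u, 0 < u → HasDerivAt (fun s => 4 * s * a₁ s + γ * s * a s)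
      (m ^ 2 / u * a u - m * (ρ + Rc * ((1 - Real.exp (-(γ * u / 4))) / (2 * Real.pi * u))) * b u
        + γ * m * Rc / 2 * (γ / (4 * Real.pi) * Real.exp (-(γ * u / 4))) * φb u - f₁ u) u)
    (hΦb : ∀ u, 0 < u → HasDerivAt (fun s => 4 * s * b₁ s + γ * s * b s)
      (m ^ 2 / u * b u + m * (ρ + Rc * ((1 - Real.exp (-(γ * u / 4))) / (2 * Real.pi * u))) * a u
        - γ * m * Rc / 2 * (γ / (4 * Real.pi) * Real.exp (-(γ * u / 4))) * φa u - f₂ u) u)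
    (hPa : ∀ u, 0 < u → HasDerivAt (fun s => s * φa₁ s) ((m ^ 2 / u * φa u - a u) / 4) u)
    (hPb : ∀ u, 0 < u → HasDerivAt (fun s => s * φb₁ s) ((m ^ 2 / u * φb u - b u) / 4) u)
    (hsuppa : ∀ u, U ≤ u → a u = 0) (hsuppb : ∀ u, U ≤ u → b u = 0)
    (hsuppφa : ∀ u, U ≤ u → φa u = 0) (hsuppφb : ∀ u, U ≤ u → φb u = 0)
    (hf₁ : ∀ u, 0 < u → (1 + u) ^ 2 * |f₁ u| ≤ M) (hf₂ : ∀ u, 0 < u → (1 + u) ^ 2 * |f₂ u| ≤ M)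
    (hNa : ∀ u, 0 < u → u * |a u| ≤ N) (hNb : ∀ u, 0 < u → u * |b u| ≤ N) :
    ∀ u, u₀ ≤ u → u ^ 4 * (a u ^ 2 + b u ^ 2)
      ≤ max (16 * (M + γ ^ 2 * Rc / (8 * Real.pi * |m|) * ((1 + u₀) ^ 2 * Real.exp (-(γ * u₀ / 4))) * N) ^ 2 / γ ^ 2)
          (u₀ ^ 4 * (a u₀ ^ 2 + b u₀ ^ 2)) := by
  have hπ : 0 < Real.pi := Real.pi_pos
  have hu₀0 : 0 < u₀ := lt_of_lt_of_le (by positivity) hu₀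
  have hm2 : 0 < m ^ 2 := by positivity
  have habsm : 0 < |m| := abs_pos.mpr hm
  -- the Biot–Savart coefficient and the folded forcing
  set cB : ℝ → ℝ := fun u => γ * m * Rc / 2 * (γ / (4 * Real.pi) * Real.exp (-(γ * u / 4))) with hcBdef
  set V : ℝ → ℝ := fun u => m * (ρ + Rc * ((1 - Real.exp (-(γ * u / 4))) / (2 * Real.pi * u))) with hVdef
  set F₁ : ℝ → ℝ := fun u => f₁ u - cB u * φb u with hF₁def
  set F₂ : ℝ → ℝ := fun u => f₂ u + cB u * φa u with hF₂def
  -- stream coefficients are bounded by `N/m²`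
  have hφa_bd := abs_streamCoeff_le (φ := φa) (φ₁ := φa₁) (w := a) hm hU hφa hφa0 hderφa hPa hNa hsuppφa
  have hφb_bd := abs_streamCoeff_le (φ := φb) (φ₁ := φb₁) (w := b) hm hU hφb hφb0 hderφb hPb hNb hsuppφb
  -- the folded data bound on `(u₀, ∞)`
  set M_E : ℝ := M + γ ^ 2 * Rc / (8 * Real.pi * |m|) * ((1 + u₀) ^ 2 * Real.exp (-(γ * u₀ / 4))) * N with hMEdef
  have hN0 : 0 ≤ N := le_trans (by positivity) (hNa 1 one_pos)
  have h8 : 8 / γ ≤ 1 + u₀ := by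
    have : 8 / γ ≤ 64 / γ := div_le_div_of_nonneg_right (by norm_num) hγ.le
    linarith
  have hsource : ∀ u, u₀ < u → ∀ φv : ℝ, |φv| ≤ N / m ^ 2 →
      (1 + u) ^ 2 * |cB u * φv| ≤ γ ^ 2 * Rc / (8 * Real.pi * |m|) * ((1 + u₀) ^ 2 * Real.exp (-(γ * u₀ / 4))) * N := by
    intro u hu φv hφv
    have hdec := sq_mul_exp_neg_antitone hγ h8 hu.le
    have hE0 : 0 < Real.exp (-(γ * u / 4)) := Real.exp_pos _
    rw [abs_mul]
    have hcB : |cB u| = γ * |m| * Rc / 2 * (γ / (4 * Real.pi) * Real.exp (-(γ * u / 4))) := by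
      simp only [hcBdef]
      have e : γ * m * Rc / 2 * (γ / (4 * Real.pi) * Real.exp (-(γ * u / 4)))
          = m * (γ * Rc / 2 * (γ / (4 * Real.pi) * Real.exp (-(γ * u / 4)))) := by ring
      rw [e, abs_mul, abs_of_nonneg (by positivity : (0:ℝ) ≤ γ * Rc / 2 * (γ / (4 * Real.pi) * Real.exp (-(γ * u / 4))))]
      ring
    rw [hcB]
    have h1 : (1 + u) ^ 2 * (γ * |m| * Rc / 2 * (γ / (4 * Real.pi) * Real.exp (-(γ * u / 4))) * |φv|)
        = γ ^ 2 * Rc / (8 * Real.pi) * |m| * ((1 + u) ^ 2 * Real.exp (-(γ * u / 4))) * |φv| := by ring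
    rw [h1]
    have h2 : γ ^ 2 * Rc / (8 * Real.pi) * |m| * ((1 + u) ^ 2 * Real.exp (-(γ * u / 4))) * |φv|
        ≤ γ ^ 2 * Rc / (8 * Real.pi) * |m| * ((1 + u₀) ^ 2 * Real.exp (-(γ * u₀ / 4))) * (N / m ^ 2) := by
      apply mul_le_mul (mul_le_mul_of_nonneg_left hdec (by positivity)) hφv (abs_nonneg _) (by positivity)
    have e : γ ^ 2 * Rc / (8 * Real.pi) * |m| * ((1 + u₀) ^ 2 * Real.exp (-(γ * u₀ / 4))) * (N / m ^ 2)
        = γ ^ 2 * Rc / (8 * Real.pi * |m|) * ((1 + u₀) ^ 2 * Real.exp (-(γ * u₀ / 4))) * N := by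
      have : m ^ 2 = |m| ^ 2 := (sq_abs m).symm
      rw [this]; field_simp
    linarith [h2, e]
  have hF₁ : ∀ u, u₀ < u → (1 + u) ^ 2 * |F₁ u| ≤ M_E := by
    intro u hu
    have hu0 : 0 < u := lt_trans hu₀0 hu
    have h1 : |F₁ u| ≤ |f₁ u| + |cB u * φb u| := by simp only [hF₁def]; exact abs_sub _ _
    have h2 := hsource u hu (φb u) (hφb_bd u hu0.le)
    have h3 := hf₁ u hu0
    have h1' := mul_le_mul_of_nonneg_left h1 (show 0 ≤ (1 + u) ^ 2 by positivity)
    rw [hMEdef]; linarith [h1', h2, h3, mul_add ((1 + u) ^ 2) (|f₁ u|) (|cB u * φb u|)]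
  have hF₂ : ∀ u, u₀ < u → (1 + u) ^ 2 * |F₂ u| ≤ M_E := by
    intro u hu
    have hu0 : 0 < u := lt_trans hu₀0 hu
    have h1 : |F₂ u| ≤ |f₂ u| + |cB u * φa u| := by simp only [hF₂def]; exact abs_add_le _ _
    have h2 := hsource u hu (φa u) (hφa_bd u hu0.le)
    have h3 := hf₂ u hu0
    have h1' := mul_le_mul_of_nonneg_left h1 (show 0 ≤ (1 + u) ^ 2 by positivity)
    rw [hMEdef]; linarith [h1', h2, h3, mul_add ((1 + u) ^ 2) (|f₂ u|) (|cB u * φa u|)]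
  -- the flux equations in folded form
  have hA : ∀ u, u₀ < u → HasDerivAt (fun s => 4 * s * a₁ s + γ * s * a s) (m ^ 2 / u * a u - V u * b u - F₁ u) u :=
    fun u hu => (hΦa u (lt_trans hu₀0 hu)).congr_deriv (by simp only [hVdef, hF₁def, hcBdef]; ring)
  have hB : ∀ u, u₀ < u → HasDerivAt (fun s => 4 * s * b₁ s + γ * s * b s) (m ^ 2 / u * b u + V u * a u - F₂ u) u :=
    fun u hu => (hΦb u (lt_trans hu₀0 hu)).congr_deriv (by simp only [hVdef, hF₂def, hcBdef]; ring)
  have hsub : Ici u₀ ⊆ Ici (0:ℝ) := fun u hu => le_trans hu₀0.le hu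
  have hext := azimuthalBlock_exterior (m := m) (V := V) hγ hu₀ (ha.mono hsub) (hb.mono hsub)
    (fun u hu => hdera u (lt_trans hu₀0 hu)) (fun u hu => hderb u (lt_trans hu₀0 hu)) hA hB hF₁ hF₂ hsuppa hsuppb
  simpa [hMEdef] using hext

end Summit.NavierStokesRegularity.NavierStokesRegularity.Theorems.DefectColumnGate

end
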